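import Summits.BirchSwinnertonDyer.Rank1Residual.X12.InertCoreEveryCurve
import Literature.NumberTheory.EllipticCurves.AgasheRibetStein2006.ManinConstantOptimalCurves
import HarnessLib

/-!
# X12 inert-bad core at `p ≥ 5`, conductor `≤ 130000`: the upper half of `BSD(E,p)` for EVERY curve,
# Cremona's theorem (Agashe–Ribet–Stein 2006 Thm. 2.6) in place of Edixhoven — no class list

HONEST FRAMING (cell `b2b-bsdres`, run/shared/lean/b2b/bsd-rank1-residual/, verbatim in every
file): the goal of the cell is to DELETE the COMBINATION-SHAPED residual classes of the
Birch–Swinnerton-Dyer formula for ALL analytic-rank `≤ 1` elliptic curves over `ℚ` — "full BSD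
formula for every rank `≤ 1` curve in class `C`" assembled STRICTLY from published theorems — so
that the rank-`≤ 1` remainder becomes exactly the CONSTRUCTION-SHAPED classes, which are TYPED
(missing-input `Prop`s), NOT attempted. This is not "finishing BSD". Class X12 is
CONSTRUCTION-SHAPED and stays so; research-route record of the unit `b2b-bsdres-x1b` (X12 prover
owner, gen 19); no claim beyond the stated class; nothing here is booked.

Companion of `InertCoreEveryCurve.lean` (the inert core at `p ≥ 11`, every curve, Edixhoven 1991
Thm. 3 + Deuring for the Manin datum of the strong member). At `p ∈ {5, 7}` Edixhoven's `p > 7` is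
not available; for conductor `≤ 130000` Cremona's theorem — Agashe–Ribet–Stein 2006 Thm. 2.6 (binder
`h26 : cremona_abs_maninConstant_eq_one_of_level_le`): `c = 1` for every OPTIMAL curve of conductor
`≤ 130000` — discharges the Manin datum of the UNIDENTIFIED strong member `W₀ ∼ W` supplied by
Modularity (`exists_isIsogenous_optimal`: `N_{W₀} = N_W`), gen 9's upper half
`missingUpperBoundAt_of_classX12_of_not_cmRamified'` applies to `W₀`, and Cassels moves it to `W`
(`missingUpperBoundAt_of_isIsogenous`). So for EVERY globally minimal `W` of conductor `≤ 130000`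
with `ClassX12 W p`, `5 ≤ p`, `p ∤ d_K` (the inert-bad core and the split-bad corner): the upper
half, `BSD(E,p) ⟺ MissingLowerBoundAt`, `X12.MissingInputAt ⇐ lower half`, and route T-KR
(`BSD(E,p)` from `r_an = 1` + a certified `p`-adic unit `#Ш_an`) — with NO class list (the gen-9
instance `ManinConstantX12Core` keyed the same conclusion to 84 named window classes) and NO
identification of which curve of the class is optimal. Census (x1b gen 14 `TKR5-OFFER-995.tsv`):
173 cells at `p ∈ {5,7}`, `N ≤ 130000` (all 42 window cells at `p ∈ {5,7}` included); the 258 cells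
at `p ∈ {5,7}`, `N > 130000` keep the per-pair Manin datum (Cremona `opt_man`). Nothing is booked;
no label moves.

References: A. Agashe, K. Ribet, W. Stein, PAMQ 2 (2006) Thm. 2.6 and appendix Thm. 5.2; A. Matar,
J. Nekovář, JTNB 31 (2019) Thm. 0.3, §0.11; J. S. Milne, *ADT* I.7.3 (Cassels); HOME
`b2b-bsdres-x1b/X12-ROUTE.md` §23.
-/

set_option autoImplicit false

noncomputable section

open scoped Classical NumberField

open WeierstrassCurve NumberField IsDedekindDomain Literature.NumberTheory.EllipticCurves
  Literature.NumberTheory.EllipticCurves.ModularForms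
  Literature.NumberTheory.EllipticCurves.Rank1Residual
  Literature.NumberTheory.EllipticCurves.Rank1Residual.Typed
  Literature.NumberTheory.Automorphic
  Literature.NumberTheory.EllipticCurves.Wuthrich2014

namespace Summit.BirchSwinnertonDyer.Rank1Residual.X12

/-! ### The core at `p ≥ 5`, conductor `≤ 130000`: every curve, Cremona instead of Edixhoven -/

/-- **X12 INERT-BAD CORE (and the split-bad corner), `p ≥ 5`, `N ≤ 130000`, EVERY CURVE: the upper
half of `BSD(E,p)` from published facts alone.** For EVERY globally minimal `W/ℚ` of conductor
`≤ 130000` with `ClassX12 W p`, `5 ≤ p`, `p ∤ d_K`: `MissingUpperBoundAt W p` — the Manin datum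
of gen 9's `missingUpperBoundAt_of_classX12_of_not_cmRamified'` is discharged on the (unidentified)
strong member `W₀ ∼ W` supplied by Modularity by Cremona's theorem (`h26`, ARS06 Thm. 2.6: `c = 1`
for every optimal curve of conductor `≤ 130000`; `N_{W₀} = N_W`), and the half moves to `W` by
Cassels. [cite: AgasheRibetStein2006, Thm. 2.6 and appendix Thm. 5.2 (first sentence), pp. 619, 633]
[cite: MatarNekovar2019, Thm. 0.3 and §0.11] [cite: MilneADT2006, Thm. I.7.3 and Remark I.7.4] -/
theorem missingUpperBoundAt_of_classX12_of_not_cmRamified_of_conductorNorm_le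
    (hGZ : ∀ (N : ℕ) [NeZero N] (W : WeierstrassCurve ℚ) (K : Type) [Field K] [NumberField K],
      gross_zagier N W K)
    (hKo : ∀ (N : ℕ) [NeZero N] (W : WeierstrassCurve ℚ) (K : Type) [Field K] [NumberField K],
      kolyvagin N W K)
    (hMN : ∀ (N : ℕ) [NeZero N] (W : WeierstrassCurve ℚ) (K : Type) [Field K] [NumberField K],
      MatarNekovar2019.thm03_padicValNat_card_sha_le_of_irreducible N W K)
    (hGZK : rank_eq_analyticRank_of_analyticRank_le_one) (hmod : hasEntireLFunction_rat)
    (hnf : exists_isNewformOf) (hFH : friedbergHoffstein_exists_heegnerField_split_twist_ne_zero)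
    (hCM8 : bsdTriple_of_hasCM_of_L_one_ne_zero)
    (h26 : AgasheRibetStein2006.cremona_abs_maninConstant_eq_one_of_level_le)
    (hCassels : bsdRHS_eq_of_isIsogenous)
    (W : WeierstrassCurve ℚ) [W.IsElliptic] [W.IsGloballyMinimal] (p : ℕ) [Fact p.Prime]
    (hX : ClassX12 W p)
    (hp5 : 5 ≤ p) (hnr : ¬ CMRamified W p) (hN : W.conductorNorm ℤ ≤ 130000) :
    MissingUpperBoundAt W p := by
  obtain ⟨W₀, hE₀, hM₀, hN₀, D₀, hiso, hNeq, hopt⟩ := exists_isIsogenous_optimal hnf W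
  have hX₀ : ClassX12 W₀ p := (classX12_iff_of_isIsogenous hiso p).mp hX
  have hnr₀ : ¬ CMRamified W₀ p := fun h ↦ hnr ((cmRamified_iff_of_isIsogenous hiso hX.1 p).mpr h)
  have hc : ¬ (p : ℤ) ∣ D₀.c :=
    AgasheRibetStein2006.not_dvd_maninConstant_of_level_le h26 W₀ D₀ hopt (by rw [hNeq]; exact hN)
      Fact.out
  have hup₀ : MissingUpperBoundAt W₀ p :=
    missingUpperBoundAt_of_classX12_of_not_cmRamified' hGZ hKo hMN hGZK hmod hnf hFH hCM8 W₀ p hX₀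
      hp5 hnr₀ D₀ hc
  exact missingUpperBoundAt_of_isIsogenous hCassels hiso (hGZK W₀ (by rw [hX₀.2.1])).2
    (W₀.leadingLCoeff_ne_zero_holds (hmod W₀)) hup₀

/-- **`BSD(E,p)` at `p ≥ 5`, `N ≤ 130000`, every curve of an X12 class with `p ∤ d_K`, from the
curve's own lower half.**
[cite: AgasheRibetStein2006, Thm. 2.6] [cite: MatarNekovar2019, Thm. 0.3 and §0.11] -/
theorem bsdp_of_classX12_of_not_cmRamified_of_conductorNorm_le_of_lower
    (hGZ : ∀ (N : ℕ) [NeZero N] (W : WeierstrassCurve ℚ) (K : Type) [Field K] [NumberField K],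
      gross_zagier N W K)
    (hKo : ∀ (N : ℕ) [NeZero N] (W : WeierstrassCurve ℚ) (K : Type) [Field K] [NumberField K],
      kolyvagin N W K)
    (hMN : ∀ (N : ℕ) [NeZero N] (W : WeierstrassCurve ℚ) (K : Type) [Field K] [NumberField K],
      MatarNekovar2019.thm03_padicValNat_card_sha_le_of_irreducible N W K)
    (hGZK : rank_eq_analyticRank_of_analyticRank_le_one) (hmod : hasEntireLFunction_rat)
    (hnf : exists_isNewformOf) (hFH : friedbergHoffstein_exists_heegnerField_split_twist_ne_zero)
    (hCM8 : bsdTriple_of_hasCM_of_L_one_ne_zero)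
    (h26 : AgasheRibetStein2006.cremona_abs_maninConstant_eq_one_of_level_le)
    (hCassels : bsdRHS_eq_of_isIsogenous)
    (W : WeierstrassCurve ℚ) [W.IsElliptic] [W.IsGloballyMinimal] (p : ℕ) [Fact p.Prime]
    (hX : ClassX12 W p)
    (hp5 : 5 ≤ p) (hnr : ¬ CMRamified W p) (hN : W.conductorNorm ℤ ≤ 130000)
    (hlow : MissingLowerBoundAt W p) : BSDp W p :=
  bsdp_of_missingPPartAt W p hGZK (by rw [hX.2.1])
    (missingPPartAt_of_lower_of_upper W p hlow
      (missingUpperBoundAt_of_classX12_of_not_cmRamified_of_conductorNorm_le hGZ hKo hMN hGZK hmod hnf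
        hFH hCM8 h26 hCassels W p hX hp5 hnr hN))

/-- **The typed input `X12.MissingInputAt W p` at `p ≥ 5`, `N ≤ 130000`, follows from the curve's
own lower half** (every curve, no datum; X12 stays CONSTRUCTION-SHAPED).
[cite: AgasheRibetStein2006, Thm. 2.6] [cite: MatarNekovar2019, Thm. 0.3 and §0.11] -/
theorem missingInputAt_of_classX12_of_not_cmRamified_of_conductorNorm_le_of_lower
    (hGZ : ∀ (N : ℕ) [NeZero N] (W : WeierstrassCurve ℚ) (K : Type) [Field K] [NumberField K],
      gross_zagier N W K)
    (hKo : ∀ (N : ℕ) [NeZero N] (W : WeierstrassCurve ℚ) (K : Type) [Field K] [NumberField K],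
      kolyvagin N W K)
    (hMN : ∀ (N : ℕ) [NeZero N] (W : WeierstrassCurve ℚ) (K : Type) [Field K] [NumberField K],
      MatarNekovar2019.thm03_padicValNat_card_sha_le_of_irreducible N W K)
    (hGZK : rank_eq_analyticRank_of_analyticRank_le_one) (hmod : hasEntireLFunction_rat)
    (hnf : exists_isNewformOf) (hFH : friedbergHoffstein_exists_heegnerField_split_twist_ne_zero)
    (hCM8 : bsdTriple_of_hasCM_of_L_one_ne_zero)
    (h26 : AgasheRibetStein2006.cremona_abs_maninConstant_eq_one_of_level_le)
    (hCassels : bsdRHS_eq_of_isIsogenous)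
    (W : WeierstrassCurve ℚ) [W.IsElliptic] [W.IsGloballyMinimal] (p : ℕ) [Fact p.Prime]
    (hX : ClassX12 W p) (hp5 : 5 ≤ p) (hnr : ¬ CMRamified W p) (hN : W.conductorNorm ℤ ≤ 130000)
    (hlow : MissingLowerBoundAt W p) : X12.MissingInputAt W p := fun _ ↦
  missingPPartAt_of_lower_of_upper W p hlow
    (missingUpperBoundAt_of_classX12_of_not_cmRamified_of_conductorNorm_le hGZ hKo hMN hGZK hmod hnf
      hFH hCM8 h26 hCassels W p hX hp5 hnr hN)

/-- **`BSD(E,p) ⟺ MissingLowerBoundAt W p` at `p ≥ 5`, `N ≤ 130000`, for every curve of an X12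
class with `p ∤ d_K`** (the whole inert-bad census window `N < 2·10⁴` included, `p = 5, 7` too).
[cite: AgasheRibetStein2006, Thm. 2.6] [cite: MatarNekovar2019, Thm. 0.3 and §0.11] -/
theorem bsdp_iff_missingLowerBoundAt_of_classX12_of_not_cmRamified_of_conductorNorm_le
    (hGZ : ∀ (N : ℕ) [NeZero N] (W : WeierstrassCurve ℚ) (K : Type) [Field K] [NumberField K],
      gross_zagier N W K)
    (hKo : ∀ (N : ℕ) [NeZero N] (W : WeierstrassCurve ℚ) (K : Type) [Field K] [NumberField K],
      kolyvagin N W K)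
    (hMN : ∀ (N : ℕ) [NeZero N] (W : WeierstrassCurve ℚ) (K : Type) [Field K] [NumberField K],
      MatarNekovar2019.thm03_padicValNat_card_sha_le_of_irreducible N W K)
    (hGZK : rank_eq_analyticRank_of_analyticRank_le_one) (hmod : hasEntireLFunction_rat)
    (hnf : exists_isNewformOf) (hFH : friedbergHoffstein_exists_heegnerField_split_twist_ne_zero)
    (hCM8 : bsdTriple_of_hasCM_of_L_one_ne_zero)
    (h26 : AgasheRibetStein2006.cremona_abs_maninConstant_eq_one_of_level_le)
    (hCassels : bsdRHS_eq_of_isIsogenous)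
    (W : WeierstrassCurve ℚ) [W.IsElliptic] [W.IsGloballyMinimal] (p : ℕ) [Fact p.Prime]
    (hX : ClassX12 W p) (hp5 : 5 ≤ p) (hnr : ¬ CMRamified W p) (hN : W.conductorNorm ℤ ≤ 130000) :
    BSDp W p ↔ MissingLowerBoundAt W p := by
  refine ⟨fun hb ↦ ?_, fun hlow ↦ ?_⟩
  · haveI : Finite W.sha := (hGZK W (by rw [hX.2.1])).2
    exact (lower_and_upper_of_missingPPartAt W p (missingPPartAt_of_bsdp W p hb)).1
  · exact bsdp_of_classX12_of_not_cmRamified_of_conductorNorm_le_of_lower hGZ hKo hMN hGZK hmod hnf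
      hFH hCM8 h26 hCassels W p hX hp5 hnr hN hlow

/-- **Route T-KR at `p ≥ 5`, `N ≤ 130000`, for EVERY curve with `p ∤ d_K`: `BSD(E,p)` from
`r_an = 1` and a certified `p`-adic unit `#Ш(E)_an` ALONE** — no class list (`ManinConstantX12Core`),
no identification of the optimal curve (all 72 window core pairs and every tier-P census cell).
[cite: AgasheRibetStein2006, Thm. 2.6] [cite: MatarNekovar2019, Thm. 0.3 and §0.11] -/
theorem bsdp_of_classX12_of_not_cmRamified_of_conductorNorm_le_of_shaAn_unit
    (hGZ : ∀ (N : ℕ) [NeZero N] (W : WeierstrassCurve ℚ) (K : Type) [Field K] [NumberField K],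
      gross_zagier N W K)
    (hKo : ∀ (N : ℕ) [NeZero N] (W : WeierstrassCurve ℚ) (K : Type) [Field K] [NumberField K],
      kolyvagin N W K)
    (hMN : ∀ (N : ℕ) [NeZero N] (W : WeierstrassCurve ℚ) (K : Type) [Field K] [NumberField K],
      MatarNekovar2019.thm03_padicValNat_card_sha_le_of_irreducible N W K)
    (hGZK : rank_eq_analyticRank_of_analyticRank_le_one) (hmod : hasEntireLFunction_rat)
    (hnf : exists_isNewformOf) (hFH : friedbergHoffstein_exists_heegnerField_split_twist_ne_zero)
    (hCM8 : bsdTriple_of_hasCM_of_L_one_ne_zero)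
    (h26 : AgasheRibetStein2006.cremona_abs_maninConstant_eq_one_of_level_le)
    (hCassels : bsdRHS_eq_of_isIsogenous)
    (W : WeierstrassCurve ℚ) [W.IsElliptic] [W.IsGloballyMinimal] (p : ℕ) [Fact p.Prime]
    (hX : ClassX12 W p)
    (hp5 : 5 ≤ p) (hnr : ¬ CMRamified W p) (hN : W.conductorNorm ℤ ≤ 130000) {q : ℚ}
    (hq : shaAn W = (q : ℂ)) (hv : padicValRat p q = 0) : BSDp W p :=
  bsdp_of_classX12_of_not_cmRamified_of_conductorNorm_le_of_lower hGZ hKo hMN hGZK hmod hnf hFH hCM8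
    h26 hCassels W p hX hp5 hnr hN (missingLowerBoundAt_of_shaAn_unit hq hv)



end Summit.BirchSwinnertonDyer.Rank1Residual.X12

end
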